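import Literature.NumberTheory.ModularForms.SymplecticGroupRationalPointsDense
import HarnessLib

/-!
# `ℓ`-adic real approximation for the symplectic group: `Sp_{2g}(ℤ[1/ℓ])` is dense in `Sp_{2g}(ℝ)`, and the
# `ℓ`-power Hecke orbit of every point of `𝔥_g` is dense

Layer `Literature/NumberTheory/ModularForms`, namespace `Literature.NumberTheory.ModularForms.SiegelUpperHalfSpace`.
THEOREMS ONLY (no definition, no named fact, no instance, no notation, no `sorry`): the subring `ℤ[1/ℓ]` is not
introduced as an object — a real symplectic matrix `P` is called *`ℓ`-adic* below when `ℓᵏ · P` has integer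
entries for some `k : ℕ`, written out as the predicate `∃ k, ∀ i j, ∃ z : ℤ, (ℓ : ℝ) ^ k * P i j = z`.

Companion of ★ `SymplecticGroupRationalPointsDense` (`Sp_{2g}(ℚ)` dense in `Sp_{2g}(ℝ)`, [GenestierNgo2020] Lemma 4.6.2),
with `ℚ` replaced by the dense subring `ℤ[1/ℓ]` (`ℓ ≥ 2`): the same proof — the unipotent radicals `n(Sym_l ℝ)`,
`v(Sym_l ℝ)` of the two opposite Siegel parabolics lie in the closure of the `ℓ`-adic points (symmetric matrices with
entries `⌊ℓᵏ b_{ij}⌋ / ℓᵏ` converge to `b`), and a subgroup of `Sp_{2l}(ℝ)` containing both radicals is everything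
(Artin's generation theorem, ★ `eq_top_of_unip_low_mem`).  This is the real place of STRONG APPROXIMATION for the
simply connected group `Sp_{2g}` with respect to the finite set of places `{ℓ, ∞}`' complement — in the elementary
form «`Sp_{2g}(ℤ[1/ℓ])` is dense in `Sp_{2g}(ℝ)`» ([PlatonovRapinchuk1994] Thm. 7.12; for `SL₂`:
[SerreTrees1980] II.1.4).  Consequence on the Siegel space: the orbit of any `Z ∈ 𝔥_g` under the `ℓ`-adic
symplectic matrices — the `ℓ`-POWER HECKE ORBIT, i.e. the periods of the principally polarised tori related to
`X_Z` by polarised isogenies of `ℓ`-power degree — is dense in `𝔥_g` ([MoonenOort2013Torelli] §3 (b) mechanism with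
`ℓ`-power isogenies).

Cell hodgecm-mathlib (D-0151), E-road «EQUIDIM by proof», Hecke-link line card v1.1 brick **(A3′)** (B-plan1 (g14)
2026-08-29T19:19:47Z): density with isogeny degrees prime to the level `N` (choose `ℓ ∤ N`), so that the isogeny
quotient keeps its level-`N` structure (`A[N] ⥲ B[N]`).  Count-neutral capital: HC_CM is proved only modulo the 7 printed
citations until rung 0 closes; this file discharges none of them.

## Main statements

* `dense_setOf_ellAdic` — for `2 ≤ ℓ`, the `ℓ`-adic points are dense in `Sp_{2l}(ℝ)`.
* `dense_setOf_exists_ellAdic_smul_eq` — for `2 ≤ ℓ` and `Z ∈ 𝔥_g`, `{P • Z | P ℓ-adic}` is dense in `𝔥_g`.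
* `dense_of_nonempty_of_forall_ellAdic_smul_mem` — a non-empty subset of `𝔥_g` stable under the `ℓ`-adic points is dense.

## References

* [PlatonovRapinchuk1994] V. Platonov, A. Rapinchuk, *Algebraic Groups and Number Theory* (1994), §7.4 Thm. 7.12 (strong approximation).
* [SerreTrees1980] J.-P. Serre, *Trees* (1980), Chap. II §1.4 (`SL₂(ℤ[1/p])`).
* [GenestierNgo2020] A. Genestier, B. C. Ngô, *Lectures on Shimura varieties*, Lemma 4.6.2 (real approximation).
* [MoonenOort2013Torelli] B. Moonen, F. Oort (2013), §3 (b).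
* [Artin1988] E. Artin, *Geometric Algebra*, Chap. V Thm. 5.1.
-/

set_option autoImplicit false

noncomputable section

open Matrix Function Set Filter
open scoped Topology

namespace Literature.NumberTheory.ModularForms.SiegelUpperHalfSpace

open Literature.RepresentationTheory.HeisenbergGroup.SymplecticMatrix (unip low coe_unip coe_low)
open Literature.LinearAlgebra.Matrix.SymplecticMatrix (eq_top_of_unip_low_mem)

variable {l : Type*} [DecidableEq l] [Fintype l]

/-! ## §1 The `ℓ`-adic points form a subgroup of `Sp_{2l}(ℝ)` -/

section EllAdic

omit [DecidableEq l] [Fintype l] in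
/-- Products of matrices with bounded denominators have bounded denominators: if `a·A` and `b·B` have integer entries
then so does `(a b)·(A B)`. [folklore] -/
private theorem exists_int_mul_mul {m n p : Type*} [Fintype n] {A : Matrix m n ℝ} {B : Matrix n p ℝ} {a b : ℝ}
    (hA : ∀ i j, ∃ z : ℤ, a * A i j = z) (hB : ∀ i j, ∃ z : ℤ, b * B i j = z) (i : m) (j : p) :
    ∃ z : ℤ, (a * b) * (A * B) i j = z := by
  choose zA hzA using hA
  choose zB hzB using hB
  refine ⟨∑ k, zA i k * zB k j, ?_⟩
  rw [Matrix.mul_apply, Finset.mul_sum]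
  push_cast
  refine Finset.sum_congr rfl fun k _ ↦ ?_
  rw [← hzA, ← hzB]
  ring

omit [Fintype l] in
/-- The entries of `J` are integers (`0, ±1`). [folklore] -/
private theorem exists_int_J (a b : l ⊕ l) : ∃ z : ℤ, (1 : ℝ) * Matrix.J l ℝ a b = z :=
  ⟨Matrix.J l ℤ a b, by rw [one_mul, ← Matrix.map_J l (Int.castRingHom ℝ)]; rfl⟩

variable (ℓ : ℕ)

/-- `ℓ`-adic points are closed under multiplication. [cite: PlatonovRapinchuk1994, §7.4 Thm. 7.12] -/
theorem ellAdic_mul {P Q : Matrix.symplecticGroup l ℝ}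
    (hP : ∃ k : ℕ, ∀ i j, ∃ z : ℤ, (ℓ : ℝ) ^ k * (P : Matrix (l ⊕ l) (l ⊕ l) ℝ) i j = z)
    (hQ : ∃ k : ℕ, ∀ i j, ∃ z : ℤ, (ℓ : ℝ) ^ k * (Q : Matrix (l ⊕ l) (l ⊕ l) ℝ) i j = z) :
    ∃ k : ℕ, ∀ i j, ∃ z : ℤ, (ℓ : ℝ) ^ k * ((P * Q : Matrix.symplecticGroup l ℝ) : Matrix (l ⊕ l) (l ⊕ l) ℝ) i j = z := by
  obtain ⟨k, hk⟩ := hP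
  obtain ⟨k', hk'⟩ := hQ
  refine ⟨k + k', fun i j ↦ ?_⟩
  rw [Submonoid.coe_mul, pow_add]
  exact exists_int_mul_mul hk hk' i j

/-- `1` is an `ℓ`-adic point. [cite: PlatonovRapinchuk1994, §7.4 Thm. 7.12] -/
theorem ellAdic_one :
    ∃ k : ℕ, ∀ i j, ∃ z : ℤ, (ℓ : ℝ) ^ k * ((1 : Matrix.symplecticGroup l ℝ) : Matrix (l ⊕ l) (l ⊕ l) ℝ) i j = z :=
  ⟨0, fun i j ↦ ⟨if i = j then 1 else 0, by
    rw [pow_zero, one_mul, OneMemClass.coe_one, Matrix.one_apply]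
    split_ifs <;> simp⟩⟩

/-- `ℓ`-adic points are closed under inversion (`P⁻¹ = -J Pᵀ J`). [cite: PlatonovRapinchuk1994, §7.4 Thm. 7.12] -/
theorem ellAdic_inv {P : Matrix.symplecticGroup l ℝ}
    (hP : ∃ k : ℕ, ∀ i j, ∃ z : ℤ, (ℓ : ℝ) ^ k * (P : Matrix (l ⊕ l) (l ⊕ l) ℝ) i j = z) :
    ∃ k : ℕ, ∀ i j, ∃ z : ℤ, (ℓ : ℝ) ^ k * ((P⁻¹ : Matrix.symplecticGroup l ℝ) : Matrix (l ⊕ l) (l ⊕ l) ℝ) i j = z := by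
  obtain ⟨k, hk⟩ := hP
  refine ⟨k, fun i j ↦ ?_⟩
  have hnJ : ∀ a b, ∃ z : ℤ, (1 : ℝ) * (-Matrix.J l ℝ) a b = z := fun a b ↦ by
    obtain ⟨z, hz⟩ := exists_int_J a b
    exact ⟨-z, by rw [Matrix.neg_apply, mul_neg, hz, Int.cast_neg]⟩
  have hT : ∀ a b, ∃ z : ℤ, (ℓ : ℝ) ^ k * (P : Matrix (l ⊕ l) (l ⊕ l) ℝ)ᵀ a b = z := fun a b ↦ hk b a
  rw [SymplecticGroup.coe_inv]
  have h := exists_int_mul_mul (exists_int_mul_mul hnJ hT) exists_int_J i j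
  rwa [one_mul, mul_one] at h

/-- `n(b) = (1 b; 0 1)` is `ℓ`-adic when `ℓᵏ b` has integer entries. [cite: PlatonovRapinchuk1994, §7.4 Thm. 7.12] -/
theorem ellAdic_unip {b : Matrix l l ℝ} (hb : b.IsSymm) {k : ℕ} (hbk : ∀ i j, ∃ z : ℤ, (ℓ : ℝ) ^ k * b i j = z) :
    ∃ k : ℕ, ∀ i j, ∃ z : ℤ, (ℓ : ℝ) ^ k * ((unip b hb : Matrix.symplecticGroup l ℝ) : Matrix (l ⊕ l) (l ⊕ l) ℝ) i j = z := by
  refine ⟨k, fun i j ↦ ?_⟩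
  rw [coe_unip]
  rcases i with i | i <;> rcases j with j | j
  · refine ⟨if i = j then (ℓ : ℤ) ^ k else 0, ?_⟩
    rw [fromBlocks_apply₁₁, Matrix.one_apply]; split_ifs <;> simp
  · rw [fromBlocks_apply₁₂]; exact hbk i j
  · exact ⟨0, by rw [fromBlocks_apply₂₁, Matrix.zero_apply, mul_zero, Int.cast_zero]⟩
  · refine ⟨if i = j then (ℓ : ℤ) ^ k else 0, ?_⟩
    rw [fromBlocks_apply₂₂, Matrix.one_apply]; split_ifs <;> simp

/-- `v(c) = (1 0; c 1)` is `ℓ`-adic when `ℓᵏ c` has integer entries. [cite: PlatonovRapinchuk1994, §7.4 Thm. 7.12] -/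
theorem ellAdic_low {c : Matrix l l ℝ} (hc : c.IsSymm) {k : ℕ} (hck : ∀ i j, ∃ z : ℤ, (ℓ : ℝ) ^ k * c i j = z) :
    ∃ k : ℕ, ∀ i j, ∃ z : ℤ, (ℓ : ℝ) ^ k * ((low c hc : Matrix.symplecticGroup l ℝ) : Matrix (l ⊕ l) (l ⊕ l) ℝ) i j = z := by
  refine ⟨k, fun i j ↦ ?_⟩
  rw [coe_low]
  rcases i with i | i <;> rcases j with j | j
  · refine ⟨if i = j then (ℓ : ℤ) ^ k else 0, ?_⟩
    rw [fromBlocks_apply₁₁, Matrix.one_apply]; split_ifs <;> simp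
  · exact ⟨0, by rw [fromBlocks_apply₁₂, Matrix.zero_apply, mul_zero, Int.cast_zero]⟩
  · rw [fromBlocks_apply₂₁]; exact hck i j
  · refine ⟨if i = j then (ℓ : ℤ) ^ k else 0, ?_⟩
    rw [fromBlocks_apply₂₂, Matrix.one_apply]; split_ifs <;> simp

end EllAdic

/-! ## §2 `ℓ`-adic approximation of symmetric matrices and density in `Sp_{2l}(ℝ)` -/

section Dense

variable (ℓ : ℕ)

omit [DecidableEq l] [Fintype l] in
/-- **`ℓ`-adic symmetric matrices approximate every real symmetric matrix**: `W_n := (⌊ℓⁿ b_{ij}⌋ / ℓⁿ)_{ij}` is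
symmetric, `ℓⁿ W_n` is integral, and `W_n → b` (`|W_n - b| ≤ ℓ⁻ⁿ → 0` for `ℓ ≥ 2`). [cite: SerreTrees1980, Chap. II §1.4] -/
theorem exists_seq_isSymm_ellAdic_tendsto (hℓ : 2 ≤ ℓ) {b : Matrix l l ℝ} (hb : b.IsSymm) :
    ∃ W : ℕ → Matrix l l ℝ, (∀ n, (W n).IsSymm) ∧ (∀ n i j, ∃ z : ℤ, (ℓ : ℝ) ^ n * W n i j = z) ∧
      Tendsto W atTop (𝓝 b) := by
  have hℓpos : (0 : ℝ) < ℓ := by exact_mod_cast (by omega : 0 < ℓ)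
  have hℓne : ∀ n : ℕ, ((ℓ : ℝ) ^ n) ≠ 0 := fun n ↦ pow_ne_zero n hℓpos.ne'
  refine ⟨fun n ↦ Matrix.of fun i j ↦ (⌊(ℓ : ℝ) ^ n * b i j⌋ : ℝ) / (ℓ : ℝ) ^ n, fun n ↦ ?_, fun n i j ↦ ?_, ?_⟩
  · refine Matrix.IsSymm.ext fun i j ↦ ?_
    simp only [Matrix.of_apply, hb.apply i j]
  · refine ⟨⌊(ℓ : ℝ) ^ n * b i j⌋, ?_⟩
    show (ℓ : ℝ) ^ n * ((⌊(ℓ : ℝ) ^ n * b i j⌋ : ℝ) / (ℓ : ℝ) ^ n) = _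
    rw [mul_div_cancel₀ _ (hℓne n)]
  · refine tendsto_pi_nhds.2 fun i ↦ tendsto_pi_nhds.2 fun j ↦ ?_
    simp only [Matrix.of_apply]
    -- squeeze between `b i j - (1/ℓ)^n` and `b i j`
    have hupper : ∀ n : ℕ, (⌊(ℓ : ℝ) ^ n * b i j⌋ : ℝ) / (ℓ : ℝ) ^ n ≤ b i j := fun n ↦ by
      rw [div_le_iff₀ (pow_pos hℓpos n), mul_comm]
      exact Int.floor_le _
    have hlower : ∀ n : ℕ, b i j - (1 / (ℓ : ℝ)) ^ n ≤ (⌊(ℓ : ℝ) ^ n * b i j⌋ : ℝ) / (ℓ : ℝ) ^ n := fun n ↦ by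
      rw [le_div_iff₀ (pow_pos hℓpos n), sub_mul, one_div, inv_pow, inv_mul_cancel₀ (hℓne n), mul_comm]
      have h := Int.lt_floor_add_one ((ℓ : ℝ) ^ n * b i j)
      linarith
    have hlim : Tendsto (fun n : ℕ ↦ b i j - (1 / (ℓ : ℝ)) ^ n) atTop (𝓝 (b i j)) := by
      have h0 : Tendsto (fun n : ℕ ↦ (1 / (ℓ : ℝ)) ^ n) atTop (𝓝 0) := by
        refine tendsto_pow_atTop_nhds_zero_of_lt_one (by positivity) ?_
        rw [div_lt_one hℓpos]
        exact_mod_cast (by omega : 1 < ℓ)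
      simpa using (tendsto_const_nhds (x := b i j)).sub h0
    exact tendsto_of_tendsto_of_tendsto_of_le_of_le hlim tendsto_const_nhds hlower hupper

/-- **`ℓ`-ADIC REAL APPROXIMATION FOR `Sp_{2l}`: the `ℓ`-adic points (`ℓᵏ P` integral for some `k`) are DENSE in
`Sp_{2l}(ℝ)`** for `ℓ ≥ 2` — they form a subgroup whose closure contains both unipotent radicals `n(Sym_l ℝ)`,
`v(Sym_l ℝ)`, hence is everything (★ `eq_top_of_unip_low_mem`). [cite: PlatonovRapinchuk1994, §7.4 Thm. 7.12]
[cite: SerreTrees1980, Chap. II §1.4] [cite: Artin1988, Chap. V Thm. 5.1] -/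
theorem dense_setOf_ellAdic (hℓ : 2 ≤ ℓ) :
    Dense {P : Matrix.symplecticGroup l ℝ |
      ∃ k : ℕ, ∀ i j, ∃ z : ℤ, (ℓ : ℝ) ^ k * (P : Matrix (l ⊕ l) (l ⊕ l) ℝ) i j = z} := by
  -- the `ℓ`-adic points as a subgroup
  let H : Subgroup (Matrix.symplecticGroup l ℝ) :=
    { carrier := {P | ∃ k : ℕ, ∀ i j, ∃ z : ℤ, (ℓ : ℝ) ^ k * (P : Matrix (l ⊕ l) (l ⊕ l) ℝ) i j = z}
      mul_mem' := fun {P Q} hP hQ ↦ ellAdic_mul ℓ hP hQ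
      one_mem' := ellAdic_one ℓ
      inv_mem' := fun {P} hP ↦ ellAdic_inv ℓ hP }
  -- both unipotent radicals lie in the closure of `H`
  have hn : ∀ (b : Matrix l l ℝ) (hb : b.IsSymm), unip b hb ∈ H.topologicalClosure := by
    intro b hb
    obtain ⟨W, hWs, hWz, hWt⟩ := exists_seq_isSymm_ellAdic_tendsto ℓ hℓ hb
    have hmem : ∀ n, unip (W n) (hWs n) ∈ (H : Set (Matrix.symplecticGroup l ℝ)) :=
      fun n ↦ ellAdic_unip ℓ (hWs n) (hWz n)
    have ht : Tendsto (fun n ↦ unip (W n) (hWs n)) atTop (𝓝 (unip b hb)) := by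
      rw [tendsto_subtype_rng]
      simp only [coe_unip]
      exact ((continuous_const.matrix_fromBlocks continuous_id continuous_const continuous_const).tendsto b).comp hWt
    rw [← SetLike.mem_coe, Subgroup.topologicalClosure_coe]
    exact mem_closure_of_tendsto ht (Eventually.of_forall hmem)
  have hv : ∀ (c : Matrix l l ℝ) (hc : c.IsSymm), low c hc ∈ H.topologicalClosure := by
    intro c hc
    obtain ⟨W, hWs, hWz, hWt⟩ := exists_seq_isSymm_ellAdic_tendsto ℓ hℓ hc
    have hmem : ∀ n, low (W n) (hWs n) ∈ (H : Set (Matrix.symplecticGroup l ℝ)) :=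
      fun n ↦ ellAdic_low ℓ (hWs n) (hWz n)
    have ht : Tendsto (fun n ↦ low (W n) (hWs n)) atTop (𝓝 (low c hc)) := by
      rw [tendsto_subtype_rng]
      simp only [coe_low]
      exact ((continuous_const.matrix_fromBlocks continuous_const continuous_id continuous_const).tendsto c).comp hWt
    rw [← SetLike.mem_coe, Subgroup.topologicalClosure_coe]
    exact mem_closure_of_tendsto ht (Eventually.of_forall hmem)
  have htop : H.topologicalClosure = ⊤ := eq_top_of_unip_low_mem hn hv
  have hdense : Dense (H : Set (Matrix.symplecticGroup l ℝ)) := by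
    rw [dense_iff_closure_eq, ← Subgroup.topologicalClosure_coe, htop]
    rfl
  exact hdense

/-- Every non-empty open subset of `Sp_{2l}(ℝ)` contains an `ℓ`-adic symplectic matrix. [cite: PlatonovRapinchuk1994, §7.4 Thm. 7.12] -/
theorem exists_mem_ellAdic_of_isOpen (hℓ : 2 ≤ ℓ) {U : Set (Matrix.symplecticGroup l ℝ)} (hU : IsOpen U)
    (hne : U.Nonempty) :
    ∃ P ∈ U, ∃ k : ℕ, ∀ i j, ∃ z : ℤ, (ℓ : ℝ) ^ k * (P : Matrix (l ⊕ l) (l ⊕ l) ℝ) i j = z := by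
  obtain ⟨P, hP, hPU⟩ := (dense_setOf_ellAdic ℓ hℓ).exists_mem_open hU hne
  exact ⟨P, hPU, hP⟩

end Dense

/-! ## §3 `ℓ`-power Hecke orbits in `𝔥_g` are dense -/

section Orbits

open Literature.NumberTheory.Automorphic (siegelUpperHalfSpace)

variable {g : ℕ} (ℓ : ℕ)

/-- **THE `ℓ`-POWER HECKE ORBIT OF EVERY POINT OF `𝔥_g` IS DENSE**: for `ℓ ≥ 2` and `Z ∈ 𝔥_g`, the translates `P • Z`
by `ℓ`-adic real symplectic matrices `P` (`ℓᵏ P` integral) are dense in `𝔥_g` (`Sp_{2g}(ℝ)` acts continuously and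
transitively, the `ℓ`-adic points are dense in it). [cite: PlatonovRapinchuk1994, §7.4 Thm. 7.12]
[cite: MoonenOort2013Torelli, §3 (b)] -/
theorem dense_setOf_exists_ellAdic_smul_eq (hℓ : 2 ≤ ℓ) (Z : siegelUpperHalfSpace g) :
    Dense {W : siegelUpperHalfSpace g | ∃ P : Matrix.symplecticGroup (Fin g) ℝ,
      (∃ k : ℕ, ∀ i j, ∃ z : ℤ, (ℓ : ℝ) ^ k * (P : Matrix (Fin g ⊕ Fin g) (Fin g ⊕ Fin g) ℝ) i j = z) ∧ P • Z = W} := by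
  have hcont : Continuous fun P : Matrix.symplecticGroup (Fin g) ℝ ↦ P • Z := continuous_id.smul continuous_const
  have hsurj : Function.Surjective fun P : Matrix.symplecticGroup (Fin g) ℝ ↦ P • Z := fun W ↦
    MulAction.exists_smul_eq (Matrix.symplecticGroup (Fin g) ℝ) Z W
  have hD := hsurj.denseRange.dense_image hcont (dense_setOf_ellAdic ℓ hℓ)
  refine hD.mono ?_
  rintro _ ⟨P, hP, rfl⟩
  exact ⟨P, hP, rfl⟩

/-- **A NON-EMPTY subset of `𝔥_g` stable under the `ℓ`-adic symplectic matrices is DENSE** (Moonen–Oort's mechanism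
with `ℓ`-power Hecke operators). [cite: MoonenOort2013Torelli, §3 (b)] [cite: PlatonovRapinchuk1994, §7.4 Thm. 7.12] -/
theorem dense_of_nonempty_of_forall_ellAdic_smul_mem (hℓ : 2 ≤ ℓ) {S : Set (siegelUpperHalfSpace g)} (hne : S.Nonempty)
    (hS : ∀ P : Matrix.symplecticGroup (Fin g) ℝ,
      (∃ k : ℕ, ∀ i j, ∃ z : ℤ, (ℓ : ℝ) ^ k * (P : Matrix (Fin g ⊕ Fin g) (Fin g ⊕ Fin g) ℝ) i j = z) →
      ∀ Z ∈ S, P • Z ∈ S) : Dense S := by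
  obtain ⟨Z, hZ⟩ := hne
  refine (dense_setOf_exists_ellAdic_smul_eq ℓ hℓ Z).mono ?_
  rintro W ⟨P, hP, rfl⟩
  exact hS P hP Z hZ

end Orbits

end Literature.NumberTheory.ModularForms.SiegelUpperHalfSpace

end
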